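import Summits.Ventures.PercRepro.Night2LocalDQFourCore

/-!
# PercRepro — the regime `|E ∖ G| = q` at `q = 4` for SIMPLE matroids: Theorem E's open cell `k = 3` (night-2, gen 11)

Theorem E (`localShadowHall_dq`, gen 8) proves the local form (LI_G) at a rank-`(q+1)` flat `G` with
`|E ∖ G| = q` whenever the coloop count `k` of `M|G` satisfies `2k ≤ (q+1−k)²`; `k ≥ q` is
`localShadowHall_of_kColoops`.  At `q = 4` this leaves exactly `k = 3`.  With the structure lemmas of
`Night2LocalDQFourCore.lean` (no layer-2 weight at a shadow set with `4` coloops; at most one member with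
`|G ∖ cl B| = 2` carries layer-2 weight at a shadow set with `3` coloops and a layer-0 covering preimage):

* `w2_le_dq_div`: the refined weight bound `w₂(B, S) ≤ 2ℓ*/(|G ∖ cl B| − 1)`, `ℓ* = k/((q+1)²(q+1−k))`;
* `load2_le_cap2_of_three`: the column bound `load₂(S) ≤ cap₂(S)` at a shadow set with `3` coloops
  (`k₁(S) = 0`: `3·(3/25) ≤ 10/25`; `k₁(S) ≥ 1`: `3/25 + 2·(3/50) ≤ 7/25`);
* **`localShadowHall_dq_four_three`** (`k = 3`) and **`localShadowHall_dq_four_of_simple`** (every `k`): the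
  local form at every rank-`5` flat with `|E ∖ G| = 4` of a loopless simple matroid — the regime `d = q` of the
  `(6, 4)` shadow row is closed for simple matroids.
-/

open scoped Matroid

namespace PercRepro.Shadow

open Finset PerFlat ThmH

variable {α : Type*} [DecidableEq α] {M : Matroid α} [M.Finite]

section Assembly

variable {G S : Finset α}

open scoped Classical in
/-- **The refined layer-2 weight bound at `d = q`**: `w₂(B, S) ≤ 2ℓ*/(|G ∖ cl B| − 1)` for `B ∈ ex2`,
`ℓ* = k/((q+1)²(q+1−k))`. -/
theorem w2_le_dq_div {q : ℕ} (hG : G ∈ flatsQ M (q + 1)) (hd : (gr M \ G).card = q)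
    (hk : kColoops M G ≤ q) {B : Finset α} (hB : B ∈ ex2 M q G S) :
    w2 M q G B S ≤ 2 * ((kColoops M G : ℚ) / ((((q : ℚ) + 1) ^ 2) * (((q : ℚ) + 1) - (kColoops M G : ℚ)))) /
      (((G \ clF M B).card : ℚ) - 1) := by
  obtain ⟨hBm, hB0, hBS, hsub, hcard⟩ := mem_ex2_unpack hB
  have hm : 2 ≤ (G \ clF M B).card := hcard ▸ Finset.card_le_card hsub
  have hden : (0 : ℚ) ≤ ((G \ clF M B).card : ℚ) - 1 := by
    have : (2 : ℚ) ≤ ((G \ clF M B).card : ℚ) := by exact_mod_cast hm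
    linarith
  have hloss : ∀ z ∈ S \ B, loss M q G B z ≤
      (kColoops M G : ℚ) / ((((q : ℚ) + 1) ^ 2) * (((q : ℚ) + 1) - (kColoops M G : ℚ))) := by
    intro z hz
    have hz' : z ∈ G \ clF M B := hsub hz
    refine (loss_le_dq hG hd hBm hB0 hz').trans (lossBound_mono ?_ hk)
    have hSG' : insert z B ⊆ G :=
      subset_of_mem_shadowAt (insert_mem_shadowAt (Finset.Subset.refl _) hG hBm hz')
    exact k1_le_kColoops hSG'
  have hsum : ∑ z ∈ S \ B, loss M q G B z ≤
      2 * ((kColoops M G : ℚ) / ((((q : ℚ) + 1) ^ 2) * (((q : ℚ) + 1) - (kColoops M G : ℚ)))) := by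
    calc ∑ z ∈ S \ B, loss M q G B z
        ≤ ∑ _z ∈ S \ B, (kColoops M G : ℚ) / ((((q : ℚ) + 1) ^ 2) * (((q : ℚ) + 1) - (kColoops M G : ℚ))) :=
          Finset.sum_le_sum hloss
      _ = 2 * ((kColoops M G : ℚ) / ((((q : ℚ) + 1) ^ 2) * (((q : ℚ) + 1) - (kColoops M G : ℚ)))) := by
          rw [Finset.sum_const, hcard, nsmul_eq_mul]; push_cast; ring
  unfold w2
  rw [if_pos ⟨hB0, hBS, hsub, hcard⟩]
  exact div_le_div_of_nonneg_right hsum hden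

open scoped Classical in
/-- **The column bound at `q = 4`, `k = 3`, three coloops of `S`** (loopless simple `M`):
`load₂(S) ≤ cap₂(S)`. -/
theorem load2_le_cap2_of_three (hs : ∀ e ∈ gr M, ∀ f ∈ gr M, e ≠ f → rkN M {e, f} = 2)
    (hl : ∀ e ∈ gr M, M.Indep {e}) (hG : G ∈ flatsQ M (4 + 1)) (hd : (gr M \ G).card = 4)
    (hk : kColoops M G = 3) (hS : S ∈ shadowAt M (4 + 2) 4 (Uq M (4 + 2) 4) G)
    (ha : (coloops M S).card = 3) : load2 M 4 G S ≤ cap2 M 4 G S := by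
  have hSG : S ⊆ G := subset_of_mem_shadowAt hS
  have hex : 2 * (ex2 M 4 G S).card ≤ (4 + 2 - 3) * (4 + 1 - 3) := by
    have := two_mul_card_ex2_le hG hS
    rwa [ha] at this
  have hex3 : (ex2 M 4 G S).card ≤ 3 := by omega
  have hcap := cap2_ge_dq hG hd hS
  rw [ha] at hcap
  have hk1 : k1 M 4 G S ≤ 3 := hk ▸ k1_le_kColoops hSG
  have hk1' : (k1 M 4 G S : ℚ) ≤ 3 := by exact_mod_cast hk1
  have hstar : 2 * ((kColoops M G : ℚ) / ((((4 : ℕ) : ℚ) + 1) ^ 2 * ((((4 : ℕ) : ℚ) + 1) - (kColoops M G : ℚ))))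
      = 3 / 25 := by
    rw [hk]; norm_num
  by_cases hk10 : k1 M 4 G S = 0
  · -- no layer-0 preimage: cap₂ ≥ 10/25 and load₂ ≤ 3·(3/25)
    have hload := load2_le_dq hG hd (by omega) S
    rw [hstar] at hload
    have hex3' : ((ex2 M 4 G S).card : ℚ) ≤ 3 := by exact_mod_cast hex3
    rw [hk10] at hcap
    norm_num at hcap
    nlinarith [hload, hcap, hex3']
  · -- a layer-0 preimage: at most one member with |G ∖ cl B| = 2
    have hk11 : 1 ≤ k1 M 4 G S := Nat.one_le_iff_ne_zero.2 hk10
    have hw : ∀ B ∈ ex2 M 4 G S,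
        w2 M 4 G B S ≤ if (G \ clF M B).card = 2 then (3 : ℚ) / 25 else 3 / 50 := by
      intro B hB
      have h := w2_le_dq_div hG hd (by omega) hB
      rw [hstar] at h
      have hm : 2 ≤ (G \ clF M B).card := by
        obtain ⟨-, -, -, hsub, hcard⟩ := mem_ex2_unpack hB
        exact hcard ▸ Finset.card_le_card hsub
      split_ifs with h2
      · rw [h2] at h
        norm_num at h
        exact h
      · have h3 : (3 : ℚ) ≤ ((G \ clF M B).card : ℚ) := by
          have : 3 ≤ (G \ clF M B).card := by omega
          exact_mod_cast this
        calc w2 M 4 G B S ≤ 3 / 25 / (((G \ clF M B).card : ℚ) - 1) := h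
          _ ≤ 3 / 25 / 2 := by
              apply div_le_div_of_nonneg_left (by norm_num) (by norm_num)
              linarith
          _ = 3 / 50 := by norm_num
    have hload : load2 M 4 G S ≤
        ∑ B ∈ ex2 M 4 G S, (if (G \ clF M B).card = 2 then (3 : ℚ) / 25 else 3 / 50) := by
      unfold load2
      rw [← Finset.sum_filter_ne_zero]
      exact Finset.sum_le_sum (fun B hB => hw B hB)
    rw [Finset.sum_ite, Finset.sum_const, Finset.sum_const, nsmul_eq_mul, nsmul_eq_mul] at hload
    have hA : ((ex2 M 4 G S).filter (fun B => (G \ clF M B).card = 2)).card ≤ 1 := by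
      rw [Finset.card_le_one]
      intro B₁ hB₁ B₂ hB₂
      rw [Finset.mem_filter] at hB₁ hB₂
      by_contra hne
      exact not_two_ex2_of_card_two hs hl hG hd hk hS ha hk11 hB₁.1 hB₂.1 hne hB₁.2 hB₂.2
    have hAC : ((ex2 M 4 G S).filter (fun B => (G \ clF M B).card = 2)).card +
        ((ex2 M 4 G S).filter (fun B => ¬ (G \ clF M B).card = 2)).card = (ex2 M 4 G S).card :=
      Finset.card_filter_add_card_filter_not _
    have hA' : (((ex2 M 4 G S).filter (fun B => (G \ clF M B).card = 2)).card : ℚ) ≤ 1 := by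
      exact_mod_cast hA
    have hC' : (((ex2 M 4 G S).filter (fun B => ¬ (G \ clF M B).card = 2)).card : ℚ) ≤
        3 - (((ex2 M 4 G S).filter (fun B => (G \ clF M B).card = 2)).card : ℚ) := by
      have : ((ex2 M 4 G S).filter (fun B => ¬ (G \ clF M B).card = 2)).card ≤
          3 - ((ex2 M 4 G S).filter (fun B => (G \ clF M B).card = 2)).card := by omega
      have h1 : (((ex2 M 4 G S).filter (fun B => (G \ clF M B).card = 2)).card : ℚ) ≤ 3 := by
        exact_mod_cast (show ((ex2 M 4 G S).filter (fun B => (G \ clF M B).card = 2)).card ≤ 3 by omega)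
      have h2 := Nat.cast_le (α := ℚ) |>.2 this
      rw [Nat.cast_sub (by omega)] at h2
      push_cast at h2
      exact h2
    have hcap' : (7 : ℚ) / 25 ≤ cap2 M 4 G S := by
      refine le_trans ?_ hcap
      norm_num
      linarith
    calc load2 M 4 G S ≤ _ := hload
      _ ≤ 7 / 25 := by nlinarith [hA', hC']
      _ ≤ cap2 M 4 G S := hcap'

/-- **Theorem E's open cell at `q = 4`**: the local form at a rank-`5` flat `G` with `|E ∖ G| = 4` whose
restriction `M|G` has exactly `3` coloops, for a loopless simple matroid. -/
theorem localShadowHall_dq_four_three (hs : ∀ e ∈ gr M, ∀ f ∈ gr M, e ≠ f → rkN M {e, f} = 2)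
    (hl : ∀ e ∈ gr M, M.Indep {e}) (hG : G ∈ flatsQ M (4 + 1)) (hd : (gr M \ G).card = 4)
    (hk : kColoops M G = 3) : LocalShadowHall M 4 G := by
  classical
  apply localShadowHall_of_distance_two hG hd.le
  intro S hS
  have hSG : S ⊆ G := subset_of_mem_shadowAt hS
  have hSE : S ⊆ gr M := hSG.trans (mem_flatsQ.1 hG).1
  have ha3 : 3 ≤ (coloops M S).card := hk ▸ kColoops_le_card_coloops hS
  have ha5 : (coloops M S).card ≤ 4 + 1 :=
    card_coloops_le hSE (eRk_eq_of_mem_Yq_diag (mem_shadow.1 (mem_shadowAt.1 hS).1).1)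
  have hcap0 : 0 ≤ cap2 M 4 G S := cap2_nonneg (capS_nonneg' hG hd.le S)
  obtain ⟨a, hadef⟩ : ∃ a, (coloops M S).card = a := ⟨_, rfl⟩
  have hcases : a = 3 ∨ a = 4 ∨ a = 5 := by omega
  rcases hcases with rfl | rfl | rfl
  · exact load2_le_cap2_of_three hs hl hG hd hk hS hadef
  · have hex := ex2_eq_empty_of_card_coloops_eq_four hs hG hS hadef
    have hload := load2_le_dq hG hd (by omega) S
    rw [hex, Finset.card_empty, Nat.cast_zero, zero_mul] at hload
    exact hload.trans hcap0
  · have hex := two_mul_card_ex2_le hG hS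
    rw [hadef] at hex
    have hex0 : (ex2 M 4 G S).card = 0 := by omega
    have hload := load2_le_dq hG hd (by omega) S
    rw [hex0, Nat.cast_zero, zero_mul] at hload
    exact hload.trans hcap0

/-- **The regime `|E ∖ G| = 4` at `q = 4` for every loopless simple matroid**: Theorem E (`k ≤ 2`),
`localShadowHall_of_kColoops` (`k ≥ 4`) and the cell `k = 3` above. -/
theorem localShadowHall_dq_four_of_simple (hs : ∀ e ∈ gr M, ∀ f ∈ gr M, e ≠ f → rkN M {e, f} = 2)
    (hl : ∀ e ∈ gr M, M.Indep {e}) (hG : G ∈ flatsQ M (4 + 1)) (hd : (gr M \ G).card = 4) :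
    LocalShadowHall M 4 G := by
  obtain ⟨k, hk⟩ : ∃ k, kColoops M G = k := ⟨_, rfl⟩
  by_cases h4 : 4 ≤ k
  · exact localShadowHall_of_kColoops hG hd.le (hk ▸ h4)
  · by_cases h3 : k = 3
    · exact localShadowHall_dq_four_three hs hl hG hd (hk.trans h3)
    · apply localShadowHall_dq hG hd
      rw [hk]
      have : k ≤ 2 := by omega
      interval_cases k <;> norm_num

end Assembly

end PercRepro.Shadow
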